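import Summits.Ventures.Crystal3D.Theorems.StickyWulffConstantTextureBuildSlabPlates
import HarnessLib

/-!
# TB-1 brick: the JOINT slab pigeonhole — one common slab index for all cells of a wall piece
# (lane T, crux `TextureLiminfV5`, stmt-Ventures-23912; memo HOME/wulff-p2/g25/SLAB-PLATES-g25.md §9 (2), §10)

HONEST FRAMING. Venture `Summits/Ventures/Crystal3D` (cell `crystal3d-full`), route `route-Ventures-StickyWulffConstant`, helper `--supports` the
law-v5 crux `TextureLiminfV5` (stmt-Ventures-23912).  Pure finite combinatorics (census-free, standard axioms).  No cover is built; F-C1 not moved.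

WHY.  The plate windows of neighbouring cells of one grain side must be merged into ONE window (memo §9 (1)), so all cells of a connected wall piece should use
the SAME candidate slab index `k` — each cell in its own frame (height `φ c`, base `a₀ c`).  The pigeonhole of '…SlabPlates' (`exists_band_filter_card_le`) is for
one cell; this file is the joint form: since for each cell the `m` collar bands are pairwise disjoint, the band counts summed over `k < m` are at most the cell's
defect count, hence some common `k` has `m · Σ_c #(band_k of cell c) ≤ Σ_c #(Dfx c)`.

* `sum_card_filter_band_le` — for one cell, `Σ_{k<m} #{d ∈ D : φ d ∈ band k} ≤ #D`;
* **`exists_joint_band_card_le`** — the joint pigeonhole over a finite set of cells.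
-/

noncomputable section

namespace Summit.Ventures.Crystal3D.Theorems

open Finset Summit.Ventures.Crystal3D
open Summit.Ventures.Crystal3D.Cruxes.TextureLiminf.TexShadow (E3)

/-- For one cell: the collar bands `[a₀ + k(t+7) − 3, a₀ + k(t+7) + t + 3]`, `k < m`, are pairwise disjoint, so their counts sum to at most `#D`. -/
theorem sum_card_filter_band_le (D : Finset E3) (φ : E3 → ℝ) (a₀ t : ℝ) (ht : 0 ≤ t) (m : ℕ) :
    ∑ k ∈ Finset.range m, (D.filter fun d => a₀ + k * (t + 7) - 3 ≤ φ d ∧ φ d ≤ a₀ + k * (t + 7) + t + 3).card ≤ D.card := by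
  classical
  rw [← Finset.card_biUnion]
  · exact Finset.card_le_card (Finset.biUnion_subset.2 fun k _ => Finset.filter_subset _ _)
  · intro k _ k' _ hkk'
    rw [Function.onFun, Finset.disjoint_left]
    intro d hd hd'
    obtain ⟨-, h1, h2⟩ := Finset.mem_filter.1 hd
    obtain ⟨-, h1', h2'⟩ := Finset.mem_filter.1 hd'
    rcases lt_or_gt_of_ne hkk' with hlt | hlt
    · have hk : (k : ℝ) + 1 ≤ (k' : ℝ) := by exact_mod_cast hlt
      nlinarith
    · have hk : (k' : ℝ) + 1 ≤ (k : ℝ) := by exact_mod_cast hlt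
      nlinarith

/-- **JOINT SLAB PIGEONHOLE.**  Cells `c ∈ cells`, each with its defect set `D c`, height `φ c`, base `a₀ c`; common thickness `t ≥ 0` and `m ≥ 1` candidates.  Some
common index `k < m` has `m · Σ_c #{d ∈ D c : φ c d ∈ band_k(c)} ≤ Σ_c #(D c)`. -/
theorem exists_joint_band_card_le {ι : Type*} (cells : Finset ι) (D : ι → Finset E3) (φ : ι → E3 → ℝ) (a₀ : ι → ℝ) (t : ℝ) (ht : 0 ≤ t)
    {m : ℕ} (hm : 0 < m) :
    ∃ k : ℕ, k < m ∧ (m : ℝ) * ∑ c ∈ cells, (((D c).filter fun d =>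
        a₀ c + k * (t + 7) - 3 ≤ φ c d ∧ φ c d ≤ a₀ c + k * (t + 7) + t + 3).card : ℝ) ≤ ∑ c ∈ cells, ((D c).card : ℝ) := by
  classical
  -- the band count as a function of the common index
  set g : ℕ → ℕ := fun k => ∑ c ∈ cells, ((D c).filter fun d =>
      a₀ c + k * (t + 7) - 3 ≤ φ c d ∧ φ c d ≤ a₀ c + k * (t + 7) + t + 3).card with hg
  have htotal : ∑ k ∈ Finset.range m, g k ≤ ∑ c ∈ cells, (D c).card := by
    rw [hg, Finset.sum_comm]
    exact Finset.sum_le_sum fun c _ => sum_card_filter_band_le (D c) (φ c) (a₀ c) t ht m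
  -- pigeonhole: the minimum over `k < m` is at most the average
  obtain ⟨k, hk, hmin⟩ := Finset.exists_min_image (Finset.range m) g ⟨0, Finset.mem_range.2 hm⟩
  refine ⟨k, Finset.mem_range.1 hk, ?_⟩
  have hle : m * g k ≤ ∑ k' ∈ Finset.range m, g k' := by
    calc m * g k = ∑ k' ∈ Finset.range m, g k := by rw [Finset.sum_const, Finset.card_range, smul_eq_mul]
      _ ≤ ∑ k' ∈ Finset.range m, g k' := Finset.sum_le_sum fun k' hk' => hmin k' hk'
  have h := hle.trans htotal
  have h' : ((m * g k : ℕ) : ℝ) ≤ ((∑ c ∈ cells, (D c).card : ℕ) : ℝ) := by exact_mod_cast h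
  push_cast at h'
  rw [hg] at h'
  push_cast at h'
  exact h'

end Summit.Ventures.Crystal3D.Theorems

end
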